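import Literature.NumberTheory.EllipticCurves.AnticyclotomicPrimeDecompositionAboveProofs
import Literature.NumberTheory.GaloisRepresentations.AbsGaloisGroupCompact
import HarnessLib

/-!
# Route `ErratumRoadFive` (K2, `p ≥ 5`), crux (T) `Rest3TorsionBranchAtFive` (item
# stmt-BirchSwinnertonDyer-19702): object (O3) of THEOREM T♭ — the anticyclotomic character has OPEN IMAGE
# on the decomposition group at a prime above `p`: `κ(Γ_{K_𝔭}) ⊇ p^s ℤ_p` (memo §33.9–33.12)

Cell `bsd-stepL` (run/shared/lean/pub/bsd-stepL/), seat `bsd-stepL-bdp` (prover g15, 2026-08-27);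
`--supports stmt-BirchSwinnertonDyer-19702 --as helper`.

The hypothesis `hsurj : ∀ y, ∃ τ, (κ (res τ)).toAdd = p^s · y` of `BigRepLocalInvariants` (p483100:
Shapiro bound `#H⁰(K_𝔭, T ⊗ Λ^*) ≤ (#A₀)^{p^s}`) and of `TateTorsionRigidity.openImage_*` (p486449: (L1)
along the local character) — «`𝔭` is FINITELY DECOMPOSED in `K_∞^{ac}`» — DISCHARGED:

* `exists_forall_exists_toAdd_eq_pow_mul_of_ne_one` — for ANY field `L` and any
  continuous `f : Γ_L →ₜ* ℤ_p` that is NOT trivial, the image contains some `p^s ℤ_p` (all of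
  `p^s ℤ_p`, `p^s ∥ f σ₀`): `Γ_L` is compact, so the image is a closed subgroup containing `ℕ·x`,
  hence (`ℕ` dense in `ℤ_p`) `ℤ_p·x = p^s ℤ_p`, `x = f σ₀ = p^s·unit`. Pure topology of `ℤ_p`.
* `anticyclotomic_exists_forall_exists_toAdd_eq_pow_mul` — for `K` imaginary quadratic, `p` odd, `κ`
  an ANTICYCLOTOMIC `ℤ_p`-extension and `v ∣ p`: `∃ s, ∀ y, ∃ τ ∈ Γ_{K_v},
  (κ (res_{K_v} τ)).toAdd = p^s · y` — by the tree's PROVED `ZpExtension.decomp_not_le_kerSubgroup_above_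
  of_isAnticyclotomic_holds` (Brink 2007 Cor. 1: the decomposition group at `v ∣ p` is not killed by `κ`)
  and the previous lemma. (`res_{K_v} = absGaloisRestrict K K_v = BigGaloisRep.localMap K (Sum.inl v)`
  by `rfl`.)

HONEST FRAMING: theorems only (no definition, no named fact, no `sorry`); the anticyclotomic input is the
tree's discharged theorem; nothing is booked; no census word, tier or label moves (T7).
References: [Brink2007] Cor. 1; [Washington1997] §13.1; memo PROOF-BDP §33.9–33.12.
-/

set_option autoImplicit false
-- the Theorems namespace of this sub repeats the summit name by design (D-0017 nested layout)
set_option linter.dupNamespace false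

noncomputable section

open scoped Topology

namespace Summit.BirchSwinnertonDyer.BirchSwinnertonDyer.Theorems.AnticyclotomicLocalImage

open Field NumberField IsDedekindDomain Literature.NumberTheory.GaloisRepresentations
  Literature.NumberTheory.EllipticCurves Literature.NumberTheory.EllipticCurves.ZpExtension

universe u

/-! ### §1 A non-trivial continuous character `Γ_L → ℤ_p` has open image -/

/-- **The image of a non-trivial continuous `f : Γ_L →ₜ* ℤ_p` contains `p^s ℤ_p`** (any field `L`;
`Γ_L` is compact, the tree's `absoluteGaloisGroup_compactSpace`): with `x = f σ₀ ≠ 0`, `x = u·p^s`, the image is a closed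
subset containing `ℕ·x`, hence `ℤ_p·x = p^s ℤ_p`. [cite: Washington1997, §13.1 (the closed subgroups of ℤ_p)] -/
theorem exists_forall_exists_toAdd_eq_pow_mul_of_ne_one {L : Type u} [Field L]
    {p : ℕ} [hp : Fact p.Prime] (f : absoluteGaloisGroup L →ₜ* Multiplicative ℤ_[p])
    (hf : ∃ σ : absoluteGaloisGroup L, f σ ≠ 1) :
    ∃ s : ℕ, ∀ y : ℤ_[p], ∃ σ : absoluteGaloisGroup L, (f σ).toAdd = (p : ℤ_[p]) ^ s * y := by
  haveI := absoluteGaloisGroup_compactSpace L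
  obtain ⟨σ₀, hσ₀⟩ := hf
  set x : ℤ_[p] := (f σ₀).toAdd with hxdef
  have hx : x ≠ 0 := fun h => hσ₀ (by rw [← ofAdd_toAdd (f σ₀), ← hxdef, h, ofAdd_zero])
  -- the image `S` of `toAdd ∘ f` is closed
  set S : Set ℤ_[p] := Set.range fun σ : absoluteGaloisGroup L => (f σ).toAdd with hSdef
  have hcont : Continuous fun σ : absoluteGaloisGroup L => (f σ).toAdd :=
    continuous_toAdd.comp (map_continuous f)
  have hS : IsClosed S := (isCompact_range hcont).isClosed
  -- `ℕ·x ⊆ S` (powers of `σ₀`), hence `ℤ_p·x ⊆ S` by density of `ℕ` and closedness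
  have hnat : ∀ n : ℕ, (n : ℤ_[p]) * x ∈ S := fun n =>
    ⟨σ₀ ^ n, by
      show (f (σ₀ ^ n)).toAdd = (n : ℤ_[p]) * x
      rw [map_pow, toAdd_pow, nsmul_eq_mul, hxdef]⟩
  have hall : ∀ c : ℤ_[p], c * x ∈ S := by
    have hT : IsClosed ((fun c : ℤ_[p] => c * x) ⁻¹' S) :=
      hS.preimage (continuous_id.mul continuous_const)
    have hsub : Set.range (Nat.cast : ℕ → ℤ_[p]) ⊆ (fun c : ℤ_[p] => c * x) ⁻¹' S := by
      rintro _ ⟨n, rfl⟩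
      exact hnat n
    have huniv : (fun c : ℤ_[p] => c * x) ⁻¹' S = Set.univ := by
      apply Set.eq_univ_of_univ_subset
      rw [← PadicInt.denseRange_natCast.closure_range]
      exact hT.closure_subset_iff.mpr hsub
    intro c
    have : c ∈ (fun c : ℤ_[p] => c * x) ⁻¹' S := by rw [huniv]; exact Set.mem_univ c
    exact this
  -- `x = u · p^s`
  refine ⟨x.valuation, fun y => ?_⟩
  obtain ⟨σ, hσ⟩ := hall (y * ↑(PadicInt.unitCoeff hx)⁻¹)
  refine ⟨σ, ?_⟩
  have hσ' : (f σ).toAdd = y * ↑(PadicInt.unitCoeff hx)⁻¹ * x := hσ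
  have hxu : x = (PadicInt.unitCoeff hx : ℤ_[p]) * (p : ℤ_[p]) ^ x.valuation :=
    PadicInt.unitCoeff_spec hx
  have hu : (↑(PadicInt.unitCoeff hx)⁻¹ : ℤ_[p]) * (PadicInt.unitCoeff hx : ℤ_[p]) = 1 :=
    Units.inv_mul _
  have key : (↑(PadicInt.unitCoeff hx)⁻¹ : ℤ_[p]) * x = (p : ℤ_[p]) ^ x.valuation := by
    conv_lhs => arg 2; rw [hxu]
    rw [← mul_assoc, hu, one_mul]
  rw [hσ', mul_assoc, key, mul_comm]

/-! ### §2 The anticyclotomic character on a decomposition group above `p` -/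

/-- **(O3): the anticyclotomic character has open image on `Γ_{K_v}` for `v ∣ p`**: `K` imaginary
quadratic, `p` odd, `κ` an anticyclotomic `ℤ_p`-extension, `v` a prime of `K` above `p`; then for some
`s`, every `p^s·y` is `κ(res_{K_v} τ)` for some `τ ∈ Γ_{K_v}` — the input `hsurj` of
`BigRepLocalInvariants` and `TateTorsionRigidity.openImage_*` for `f = κ ∘ res_{K_v}`
(`res_{K_v} = absGaloisRestrict K K_v = BigGaloisRep.localMap K (Sum.inl v)`). From the tree's PROVED
`decomp_not_le_kerSubgroup_above_of_isAnticyclotomic_holds` (the decomposition group above `p` is not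
killed by `κ`). [cite: Brink2007, Cor. 1 (p. 2136)] [cite: Washington1997, §13.1] -/
theorem anticyclotomic_exists_forall_exists_toAdd_eq_pow_mul {K : Type} [Field K] [NumberField K]
    {p : ℕ} [Fact p.Prime] (hK : IsImaginaryQuadratic K) (hp2 : p ≠ 2) (κ : ZpExtension K p)
    (hκ : κ.IsAnticyclotomic) (v : HeightOneSpectrum (𝓞 K)) (hpv : ((p : ℕ) : 𝓞 K) ∈ v.asIdeal) :
    ∃ s : ℕ, ∀ y : ℤ_[p], ∃ τ : absoluteGaloisGroup (v.adicCompletion K),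
      (κ (absGaloisRestrict K (v.adicCompletion K) τ)).toAdd = (p : ℤ_[p]) ^ s * y := by
  have hnot : ¬ (GreenbergSelmer.decomp v ≤ κ.kerSubgroup) :=
    decomp_not_le_kerSubgroup_above_of_isAnticyclotomic_holds K p hK hp2 κ hκ v hpv
  have hf : ∃ τ : absoluteGaloisGroup (v.adicCompletion K),
      (κ.toContinuousMonoidHom.comp (absGaloisRestrict K (v.adicCompletion K))) τ ≠ 1 := by
    by_contra h
    push Not at h
    apply hnot
    rintro _ ⟨τ, rfl⟩
    rw [ZpExtension.mem_kerSubgroup]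
    exact h τ
  exact exists_forall_exists_toAdd_eq_pow_mul_of_ne_one
    (κ.toContinuousMonoidHom.comp (absGaloisRestrict K (v.adicCompletion K))) hf

end Summit.BirchSwinnertonDyer.BirchSwinnertonDyer.Theorems.AnticyclotomicLocalImage

end
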